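import Mathlib
import HarnessLib

/-!
# Route EternalPapapetrou · SchwarzschildExteriorModeRigidity — the transport–Grönwall core

Helper file for item stmt-FinalStateConjecture-10039 (`SchwarzschildExteriorModeRigidity`).

The proof of the exact-Schwarzschild mode-rigidity statement reduces (after projection onto a
finite family of angular test functions and temporal band-limitation) to the following abstract
`1+1`-dimensional lemma about a vector-valued "radiation field" `G(t, ρ)` on a half-line
`ρ > r₀`, its two null derivatives `P = X₋G`, `Q = X₊G`, its time derivative `Gt` (with
`Q − P = 2 Gt`) and a source `F` with `‖F‖ ≤ w(ρ) ‖G‖`, `w ∈ L¹`: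

* `P` (resp. `Q`) is transported along the outgoing (resp. ingoing) null curves
  `ρ ↦ (u + c₊(ρ), ρ)` (resp. `ρ ↦ (u − c₋(ρ), ρ)`) with source `F`, and `G` itself has
  derivative `a⁻¹ Q` (resp. `a⁻¹ P`) along them;
* `G` is bounded, `Gt → 0` uniformly in `t` as `ρ → ∞` (two-sided non-radiation), and the
  inverse-Bernstein inequality `sup_t ‖G‖ ≤ K sup_t ‖Gt‖` holds (temporal band-limitation away
  from frequency `0`).

Then `G ≡ 0`: the limits of `P`, `Q` at null infinity vanish because `G` is bounded, the
Duhamel formula along characteristics bounds `Gt` by `∫_ρ^∞ w · sup‖G‖`, the Bernstein step closes a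
backward Volterra inequality, and Picard iteration (`‖G‖ ≤ B₀ (K W(ρ))ⁿ / n!`) forces `G = 0`
(Jost/Rellich mechanism at fixed non-zero frequency; Colton–Kress 1998, Lemma 2.11).
-/

set_option linter.dupNamespace false

namespace Summit.FinalStateConjecture.FinalStateConjecture.Theorems

open MeasureTheory Set Filter Topology intervalIntegral

namespace EternalPapapetrou.ModeRigidity

variable {E : Type*} [NormedAddCommGroup E] [NormedSpace ℝ E] [CompleteSpace E]

/-- A function with an integrable derivative on a half-line has a limit at `+∞`. [folklore] -/
theorem exists_tendsto_of_hasDerivAt_of_integrableOn {f f' : ℝ → E} {a : ℝ}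
    (hderiv : ∀ x ∈ Ioi a, HasDerivAt f (f' x) x) (hint : IntegrableOn f' (Ioi a)) :
    ∃ m, Tendsto f atTop (𝓝 m) := by
  set x₀ := a + 1 with hx₀
  have hint' : IntegrableOn f' (Ioi x₀) := hint.mono_set (Ioi_subset_Ioi (by linarith))
  refine ⟨f x₀ + ∫ x in Ioi x₀, f' x, ?_⟩
  have h1 : Tendsto (fun x ↦ f x₀ + ∫ s in x₀..x, f' s) atTop
      (𝓝 (f x₀ + ∫ x in Ioi x₀, f' x)) :=
    tendsto_const_nhds.add (intervalIntegral_tendsto_integral_Ioi x₀ hint' tendsto_id)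
  refine h1.congr' ?_
  filter_upwards [eventually_ge_atTop x₀] with x hx
  have hsub : uIcc x₀ x ⊆ Ioi a := by
    rw [uIcc_of_le hx]
    exact fun s hs ↦ lt_of_lt_of_le (by linarith) hs.1
  rw [integral_eq_sub_of_hasDerivAt (fun s hs ↦ hderiv s (hsub hs))
    ((hint.mono_set hsub).intervalIntegrable)]
  abel

omit [CompleteSpace E] in
/-- If `g` is bounded on a half-line and has derivative `(a ρ)⁻¹ • q ρ` there, with
`0 < a ≤ a₁` for large `ρ`, and `q → qinf`, then `qinf = 0` (otherwise `g` grows linearly along the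
half-line). [folklore] -/
theorem limit_eq_zero_of_deriv_of_bounded {g q : ℝ → E} {a : ℝ → ℝ} {qinf : E}
    {r₀ B₀ a₁ R₁ : ℝ} (ha₁ : 0 < a₁)
    (hg : ∀ ρ ∈ Ioi r₀, HasDerivAt g ((a ρ)⁻¹ • q ρ) ρ) (hB : ∀ ρ ∈ Ioi r₀, ‖g ρ‖ ≤ B₀)
    (ha : ∀ ρ, R₁ ≤ ρ → 0 < a ρ ∧ a ρ ≤ a₁) (hq : Tendsto q atTop (𝓝 qinf)) : qinf = 0 := by
  by_contra h
  have hn : ‖qinf‖ ≠ 0 := norm_ne_zero_iff.mpr h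
  obtain ⟨ℓ, hℓ, hℓq'⟩ := exists_dual_vector ℝ qinf hn
  have hℓq : ℓ qinf = ‖qinf‖ := by simpa using hℓq'
  set δ : ℝ := ‖qinf‖ / 2 with hδ
  have hδ0 : 0 < δ := by positivity
  obtain ⟨R₂, hR₂⟩ := (Metric.tendsto_atTop.1 hq) δ hδ0
  set R : ℝ := max (max R₁ R₂) (r₀ + 1) with hR
  have hRr₀ : r₀ < R := lt_of_lt_of_le (by linarith) (le_max_right _ _)
  have hRR₁ : R₁ ≤ R := (le_max_left _ _).trans (le_max_left _ _)
  have hRR₂ : R₂ ≤ R := (le_max_right _ _).trans (le_max_left _ _)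
  have hlow : ∀ ρ, R ≤ ρ → δ ≤ ℓ (q ρ) := by
    intro ρ hρ
    have h1 : ‖q ρ - qinf‖ < δ := by
      have := hR₂ ρ (hRR₂.trans hρ)
      rwa [dist_eq_norm] at this
    have h2 : |ℓ (q ρ - qinf)| ≤ δ := by
      calc |ℓ (q ρ - qinf)| = ‖ℓ (q ρ - qinf)‖ := (Real.norm_eq_abs _).symm
        _ ≤ ‖ℓ‖ * ‖q ρ - qinf‖ := ℓ.le_opNorm _
        _ ≤ 1 * δ := by gcongr; exact hℓ.le
        _ = δ := one_mul δ
    have h3 : ℓ (q ρ) = ℓ qinf + ℓ (q ρ - qinf) := by simp [map_sub]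
    rw [h3, hℓq]
    have := (abs_le.1 h2).1
    linarith
  set h : ℝ → ℝ := fun ρ ↦ ℓ (g ρ) with hh
  have hderiv : ∀ ρ, R ≤ ρ → HasDerivAt h ((a ρ)⁻¹ * ℓ (q ρ)) ρ := by
    intro ρ hρ
    have h1 : HasDerivAt (⇑ℓ ∘ g) (ℓ ((a ρ)⁻¹ • q ρ)) ρ :=
      ℓ.hasFDerivAt.comp_hasDerivAt ρ (hg ρ (hRr₀.trans_le hρ))
    have h2 : ℓ ((a ρ)⁻¹ • q ρ) = (a ρ)⁻¹ * ℓ (q ρ) := by rw [map_smul, smul_eq_mul]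
    convert h1.congr_deriv h2 using 1 <;> rfl
  have hge : ∀ ρ, R ≤ ρ → δ / a₁ ≤ (a ρ)⁻¹ * ℓ (q ρ) := by
    intro ρ hρ
    obtain ⟨ha0, haa₁⟩ := ha ρ (hRR₁.trans hρ)
    rw [div_eq_inv_mul]
    exact mul_le_mul (by rw [inv_le_inv₀ ha₁ ha0]; exact haa₁) (hlow ρ hρ) hδ0.le
      (inv_nonneg.2 ha0.le)
  have hmono : ∀ y, R ≤ y → δ / a₁ * (y - R) ≤ h y - h R := by
    intro y hy
    have hD : Convex ℝ (Ici R) := convex_Ici R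
    have hcont : ContinuousOn h (Ici R) :=
      fun ρ hρ ↦ (hderiv ρ hρ).continuousAt.continuousWithinAt
    have hdiff : DifferentiableOn ℝ h (interior (Ici R)) := by
      rw [interior_Ici]
      exact fun ρ hρ ↦ (hderiv ρ (le_of_lt hρ)).differentiableAt.differentiableWithinAt
    have hge' : ∀ ρ ∈ interior (Ici R), δ / a₁ ≤ deriv h ρ := by
      rw [interior_Ici]
      intro ρ hρ
      rw [(hderiv ρ (le_of_lt hρ)).deriv]
      exact hge ρ (le_of_lt hρ)
    exact hD.mul_sub_le_image_sub_of_le_deriv hcont hdiff hge' R (le_refl R) y hy hy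
  have hB₀ : 0 ≤ B₀ := (norm_nonneg _).trans (hB R hRr₀)
  have hbound : ∀ ρ, R ≤ ρ → |h ρ| ≤ B₀ := by
    intro ρ hρ
    calc |h ρ| = ‖ℓ (g ρ)‖ := (Real.norm_eq_abs _).symm
      _ ≤ ‖ℓ‖ * ‖g ρ‖ := ℓ.le_opNorm _
      _ ≤ 1 * B₀ := by gcongr; exact hℓ.le; exact hB ρ (hRr₀.trans_le hρ)
      _ = B₀ := one_mul _
  set y : ℝ := R + (2 * B₀ + 1) * a₁ / δ with hy
  have hyR : R ≤ y := by
    have : 0 ≤ (2 * B₀ + 1) * a₁ / δ := by positivity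
    linarith
  have h1 := hmono y hyR
  have h2 : δ / a₁ * (y - R) = 2 * B₀ + 1 := by
    rw [hy]; field_simp; ring
  have h3 := hbound y hyR
  have h4 := hbound R le_rfl
  rw [h2] at h1
  have := (abs_le.1 h3).2
  have := (abs_le.1 h4).1
  linarith

/-- The antiderivative `W ρ = ∫_ρ^∞ w` of an integrable continuous weight: nonnegative, bounded by
the total mass, differentiable with `W' = −w` on the open half-line, and tending to `0`.
[folklore] -/
theorem tail_weight_props {w : ℝ → ℝ} {r₀ : ℝ} (hw : ContinuousOn w (Ioi r₀))
    (hw0 : ∀ ρ ∈ Ioi r₀, 0 ≤ w ρ) (hwi : IntegrableOn w (Ioi r₀)) :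
    (∀ ρ ∈ Ioi r₀, 0 ≤ ∫ x in Ioi ρ, w x) ∧
    (∀ ρ ∈ Ioi r₀, ∫ x in Ioi ρ, w x ≤ ∫ x in Ioi r₀, w x) ∧
    (∀ ρ ∈ Ioi r₀, HasDerivAt (fun ρ ↦ ∫ x in Ioi ρ, w x) (-w ρ) ρ) ∧
    Tendsto (fun ρ ↦ ∫ x in Ioi ρ, w x) atTop (𝓝 0) := by
  refine ⟨fun ρ hρ ↦ ?_, fun ρ hρ ↦ ?_, fun ρ hρ ↦ ?_, ?_⟩
  · exact setIntegral_nonneg measurableSet_Ioi fun x hx ↦ hw0 x (Set.mem_Ioi.2 (lt_trans hρ.out hx.out))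
  · exact setIntegral_mono_set hwi
      ((ae_restrict_iff' measurableSet_Ioi).2 (Eventually.of_forall hw0))
      (Ioi_subset_Ioi hρ.out.le).eventuallyLE
  · -- `W ρ' = W r₁ - ∫_{r₁}^{ρ'} w` near `ρ`, with `r₀ < r₁ < ρ`
    set r₁ := (r₀ + ρ) / 2 with hr₁
    have hr₀₁ : r₀ < r₁ := by rw [hr₁]; linarith [hρ.out]
    have hr₁ρ : r₁ < ρ := by rw [hr₁]; linarith [hρ.out]
    have hwi₁ : IntegrableOn w (Ioi r₁) := hwi.mono_set (Ioi_subset_Ioi hr₀₁.le)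
    have heq : ∀ᶠ ρ' in 𝓝 ρ, ∫ x in Ioi ρ', w x = (∫ x in Ioi r₁, w x) - ∫ x in r₁..ρ', w x := by
      filter_upwards [Ioi_mem_nhds hr₁ρ] with ρ' hρ'
      rw [← integral_Ioi_sub_Ioi hwi₁ (le_of_lt hρ')]
      ring
    have hd : HasDerivAt (fun ρ' ↦ (∫ x in Ioi r₁, w x) - ∫ x in r₁..ρ', w x) (0 - w ρ) ρ := by
      refine (hasDerivAt_const ρ _).sub ?_
      refine integral_hasDerivAt_right ?_ ?_ ?_
      · refine (hwi.mono_set ?_).intervalIntegrable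
        rw [uIcc_of_le hr₁ρ.le]
        exact fun x hx ↦ lt_of_lt_of_le hr₀₁ hx.1
      · exact hw.stronglyMeasurableAtFilter isOpen_Ioi ρ hρ
      · exact hw.continuousAt (Ioi_mem_nhds hρ)
    rw [zero_sub] at hd
    exact hd.congr_of_eventuallyEq heq
  · have h1 : Tendsto (fun ρ ↦ ∫ x in r₀..ρ, w x) atTop (𝓝 (∫ x in Ioi r₀, w x)) :=
      intervalIntegral_tendsto_integral_Ioi r₀ hwi tendsto_id
    have h2 : Tendsto (fun ρ ↦ (∫ x in Ioi r₀, w x) - ∫ x in r₀..ρ, w x) atTop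
        (𝓝 ((∫ x in Ioi r₀, w x) - ∫ x in Ioi r₀, w x)) := tendsto_const_nhds.sub h1
    rw [sub_self] at h2
    refine h2.congr' ?_
    filter_upwards [eventually_gt_atTop r₀] with ρ hρ
    rw [← integral_Ioi_sub_Ioi hwi hρ.le]
    ring

/-- `∫_ρ^∞ w · W^n = W(ρ)^{n+1}/(n+1)` for the tail `W ρ = ∫_ρ^∞ w` of a continuous integrable
nonnegative weight (the iterated-kernel identity of the Picard/Volterra series). [folklore] -/
theorem integral_Ioi_weight_mul_tail_pow {w : ℝ → ℝ} {r₀ : ℝ} (hw : ContinuousOn w (Ioi r₀))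
    (hw0 : ∀ ρ ∈ Ioi r₀, 0 ≤ w ρ) (hwi : IntegrableOn w (Ioi r₀)) (n : ℕ) {ρ : ℝ}
    (hρ : ρ ∈ Ioi r₀) :
    IntegrableOn (fun σ ↦ (∫ x in Ioi σ, w x) ^ n * w σ) (Ioi ρ) ∧
    ∫ σ in Ioi ρ, (∫ x in Ioi σ, w x) ^ n * w σ = (∫ x in Ioi ρ, w x) ^ (n + 1) / (n + 1) := by
  obtain ⟨hW0, hWle, hWd, hWlim⟩ := tail_weight_props hw hw0 hwi
  set W : ℝ → ℝ := fun ρ ↦ ∫ x in Ioi ρ, w x with hWdef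
  have hρ₀ : Ioi ρ ⊆ Ioi r₀ := Ioi_subset_Ioi hρ.out.le
  have hWc : ContinuousOn W (Ioi r₀) := fun σ hσ ↦ (hWd σ hσ).continuousAt.continuousWithinAt
  have hint : IntegrableOn (fun σ ↦ W σ ^ n * w σ) (Ioi ρ) := by
    refine Integrable.bdd_mul (c := (∫ x in Ioi r₀, w x) ^ n) (hwi.mono_set hρ₀) ?_ ?_
    · exact ((hWc.pow n).mono hρ₀).aestronglyMeasurable measurableSet_Ioi
    · refine (ae_restrict_iff' measurableSet_Ioi).2 (Eventually.of_forall fun σ hσ ↦ ?_)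
      have hσ₀ : σ ∈ Ioi r₀ := hρ₀ hσ
      rw [norm_pow, Real.norm_eq_abs, abs_of_nonneg (hW0 σ hσ₀)]
      exact pow_le_pow_left₀ (hW0 σ hσ₀) (hWle σ hσ₀) n
  refine ⟨hint, ?_⟩
  -- FTC on the half-line for `f σ = -(W σ ^ (n+1) / (n+1))`
  have hderiv : ∀ σ ∈ Ioi r₀,
      HasDerivAt (fun σ ↦ -(W σ ^ (n + 1) / (n + 1))) (W σ ^ n * w σ) σ := by
    intro σ hσ
    have hn1 : (n : ℝ) + 1 ≠ 0 := by positivity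
    have h1 : HasDerivAt (fun σ ↦ W σ ^ (n + 1)) (↑(n + 1) * W σ ^ (n + 1 - 1) * -w σ) σ :=
      (hWd σ hσ).fun_pow (n + 1)
    have h2 := (h1.div_const ((n : ℝ) + 1)).neg
    refine h2.congr_deriv ?_
    rw [Nat.add_sub_cancel]
    push_cast
    field_simp
  have hcont : ContinuousWithinAt (fun σ ↦ -(W σ ^ (n + 1) / (n + 1))) (Ici ρ) ρ :=
    (hderiv ρ hρ |>.continuousAt.continuousWithinAt)
  have hlim : Tendsto (fun σ ↦ -(W σ ^ (n + 1) / (n + 1))) atTop (𝓝 0) := by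
    have := ((hWlim.pow (n + 1)).div_const ((n : ℝ) + 1)).neg
    simpa using this
  have := integral_Ioi_of_hasDerivAt_of_tendsto hcont (fun σ hσ ↦ hderiv σ (hρ₀ hσ)) hint hlim
  rw [this]
  ring

/-- **The transport–Grönwall core of the mode-rigidity argument.** Let `G, P, Q, Gt, F` be
`E`-valued functions of `(t, ρ)`, `ρ > r₀`, with: `P` transported along the outgoing curves
`ρ ↦ (u + c₊ ρ, ρ)` and `Q` along the ingoing curves `ρ ↦ (u − c₋ ρ, ρ)` with source `F`,
`‖F‖ ≤ w(ρ)‖G‖`, `w ≥ 0` continuous and integrable; `G` differentiable along the same curves with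
derivatives `a⁻¹ Q`, `a⁻¹ P`, `0 < a ≤ a₁` for large `ρ`; `Q − P = 2 Gt`; `G` bounded; `Gt → 0`
uniformly in `t` as `ρ → ∞`; and the inverse-Bernstein inequality
`(∀ t, ‖Gt t ρ‖ ≤ b) → ∀ t, ‖G t ρ‖ ≤ K b`. Then `G ≡ 0` on `ρ > r₀`. (Jost/Rellich mechanism at
fixed non-zero frequency: Colton–Kress 1998 Lemma 2.11; DRSR arXiv:1402.7034 §4 for the separated
Regge–Wheeler equation.) [folklore] -/
theorem core_eq_zero
    (r₀ K B₀ a₁ R₁ : ℝ) (G P Q Gt F : ℝ → ℝ → E) (a cout cin w : ℝ → ℝ)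
    (hK : 0 ≤ K) (ha₁ : 0 < a₁)
    (hFc : ContinuousOn (Function.uncurry F) (univ ×ˢ Ioi r₀))
    (hcout : ContinuousOn cout (Ioi r₀)) (hcin : ContinuousOn cin (Ioi r₀))
    (hP : ∀ u, ∀ ρ ∈ Ioi r₀, HasDerivAt (fun ρ ↦ P (u + cout ρ) ρ) (F (u + cout ρ) ρ) ρ)
    (hGout : ∀ u, ∀ ρ ∈ Ioi r₀,
      HasDerivAt (fun ρ ↦ G (u + cout ρ) ρ) ((a ρ)⁻¹ • Q (u + cout ρ) ρ) ρ)
    (hQ : ∀ u, ∀ ρ ∈ Ioi r₀, HasDerivAt (fun ρ ↦ Q (u - cin ρ) ρ) (F (u - cin ρ) ρ) ρ)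
    (hGin : ∀ u, ∀ ρ ∈ Ioi r₀,
      HasDerivAt (fun ρ ↦ G (u - cin ρ) ρ) ((a ρ)⁻¹ • P (u - cin ρ) ρ) ρ)
    (hQP : ∀ t, ∀ ρ ∈ Ioi r₀, Q t ρ - P t ρ = (2 : ℝ) • Gt t ρ)
    (hF : ∀ t, ∀ ρ ∈ Ioi r₀, ‖F t ρ‖ ≤ w ρ * ‖G t ρ‖)
    (hw : ContinuousOn w (Ioi r₀)) (hw0 : ∀ ρ ∈ Ioi r₀, 0 ≤ w ρ) (hwi : IntegrableOn w (Ioi r₀))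
    (hB : ∀ t, ∀ ρ ∈ Ioi r₀, ‖G t ρ‖ ≤ B₀)
    (ha : ∀ ρ, R₁ ≤ ρ → 0 < a ρ ∧ a ρ ≤ a₁)
    (hrad : ∀ ε > 0, ∃ R, ∀ t ρ, R ≤ ρ → ‖Gt t ρ‖ ≤ ε)
    (hBern : ∀ ρ ∈ Ioi r₀, ∀ b : ℝ, (∀ t, ‖Gt t ρ‖ ≤ b) → ∀ t, ‖G t ρ‖ ≤ K * b) :
    ∀ t, ∀ ρ ∈ Ioi r₀, G t ρ = 0 := by
  have hB₀ : 0 ≤ B₀ := (norm_nonneg _).trans (hB 0 (r₀ + 1) (by simp))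
  obtain ⟨hW0, hWle, hWd, hWlim⟩ := tail_weight_props hw hw0 hwi
  set W : ℝ → ℝ := fun ρ ↦ ∫ x in Ioi ρ, w x with hWdef
  have hWc : ContinuousOn W (Ioi r₀) := fun σ hσ ↦ (hWd σ hσ).continuousAt.continuousWithinAt
  have hmaps_out : ∀ u, MapsTo (fun ρ ↦ (u + cout ρ, ρ)) (Ioi r₀) (univ ×ˢ Ioi r₀) :=
    fun u ρ hρ ↦ ⟨mem_univ _, hρ⟩
  have hmaps_in : ∀ u, MapsTo (fun ρ ↦ (u - cin ρ, ρ)) (Ioi r₀) (univ ×ˢ Ioi r₀) :=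
    fun u ρ hρ ↦ ⟨mem_univ _, hρ⟩
  have hc_out : ∀ u, ContinuousOn (fun ρ ↦ (u + cout ρ, ρ)) (Ioi r₀) :=
    fun u ↦ (continuousOn_const.add hcout).prodMk continuousOn_id
  have hc_in : ∀ u, ContinuousOn (fun ρ ↦ (u - cin ρ, ρ)) (Ioi r₀) :=
    fun u ↦ (continuousOn_const.sub hcin).prodMk continuousOn_id
  have hFo : ∀ u, ContinuousOn (fun ρ ↦ F (u + cout ρ) ρ) (Ioi r₀) :=
    fun u ↦ hFc.comp (hc_out u) (hmaps_out u)
  have hFi : ∀ u, ContinuousOn (fun ρ ↦ F (u - cin ρ) ρ) (Ioi r₀) :=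
    fun u ↦ hFc.comp (hc_in u) (hmaps_in u)
  have hFo_int : ∀ u, IntegrableOn (fun ρ ↦ F (u + cout ρ) ρ) (Ioi r₀) := by
    intro u
    refine Integrable.mono' (hwi.mul_const B₀) ((hFo u).aestronglyMeasurable measurableSet_Ioi) ?_
    refine (ae_restrict_iff' measurableSet_Ioi).2 (Eventually.of_forall fun σ hσ ↦ ?_)
    exact (hF _ σ hσ).trans (mul_le_mul_of_nonneg_left (hB _ σ hσ) (hw0 σ hσ))
  have hFi_int : ∀ u, IntegrableOn (fun ρ ↦ F (u - cin ρ) ρ) (Ioi r₀) := by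
    intro u
    refine Integrable.mono' (hwi.mul_const B₀) ((hFi u).aestronglyMeasurable measurableSet_Ioi) ?_
    refine (ae_restrict_iff' measurableSet_Ioi).2 (Eventually.of_forall fun σ hσ ↦ ?_)
    exact (hF _ σ hσ).trans (mul_le_mul_of_nonneg_left (hB _ σ hσ) (hw0 σ hσ))
  -- `Gt → 0` along any family of points going to infinity
  have hGt0 : ∀ τ : ℝ → ℝ, Tendsto (fun σ ↦ Gt (τ σ) σ) atTop (𝓝 0) := by
    intro τ
    refine Metric.tendsto_atTop.2 fun ε hε ↦ ?_
    obtain ⟨R, hR⟩ := hrad (ε / 2) (half_pos hε)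
    exact ⟨R, fun σ hσ ↦ by
      rw [dist_zero_right]; exact (hR _ σ hσ).trans_lt (half_lt_self hε)⟩
  have hPlim : ∀ u, Tendsto (fun σ ↦ P (u + cout σ) σ) atTop (𝓝 0) := by
    intro u
    obtain ⟨pinf, hp⟩ := exists_tendsto_of_hasDerivAt_of_integrableOn (hP u) (hFo_int u)
    have hQlim : Tendsto (fun σ ↦ Q (u + cout σ) σ) atTop (𝓝 pinf) := by
      have h2 : Tendsto (fun σ ↦ (2 : ℝ) • Gt (u + cout σ) σ) atTop (𝓝 ((2 : ℝ) • (0 : E))) :=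
        (hGt0 fun σ ↦ u + cout σ).const_smul 2
      rw [smul_zero] at h2
      have h3 := hp.add h2
      rw [add_zero] at h3
      refine h3.congr' ?_
      filter_upwards [eventually_gt_atTop r₀] with σ hσ
      rw [← hQP (u + cout σ) σ hσ]
      abel
    have h0 : pinf = 0 :=
      limit_eq_zero_of_deriv_of_bounded ha₁ (hGout u) (fun ρ hρ ↦ hB _ ρ hρ) ha hQlim
    rwa [h0] at hp
  have hQlim : ∀ u, Tendsto (fun σ ↦ Q (u - cin σ) σ) atTop (𝓝 0) := by
    intro u
    obtain ⟨qinf, hq⟩ := exists_tendsto_of_hasDerivAt_of_integrableOn (hQ u) (hFi_int u)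
    have hPl : Tendsto (fun σ ↦ P (u - cin σ) σ) atTop (𝓝 qinf) := by
      have h2 : Tendsto (fun σ ↦ (2 : ℝ) • Gt (u - cin σ) σ) atTop (𝓝 ((2 : ℝ) • (0 : E))) :=
        (hGt0 fun σ ↦ u - cin σ).const_smul 2
      rw [smul_zero] at h2
      have h3 := hq.sub h2
      rw [sub_zero] at h3
      refine h3.congr' ?_
      filter_upwards [eventually_gt_atTop r₀] with σ hσ
      rw [← hQP (u - cin σ) σ hσ]
      abel
    have h0 : qinf = 0 :=
      limit_eq_zero_of_deriv_of_bounded ha₁ (hGin u) (fun ρ hρ ↦ hB _ ρ hρ) ha hPl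
    rwa [h0] at hq
  have hPtail : ∀ t, ∀ ρ ∈ Ioi r₀,
      P t ρ = -∫ σ in Ioi ρ, F (t - cout ρ + cout σ) σ := by
    intro t ρ hρ
    have hsub : Ioi ρ ⊆ Ioi r₀ := Ioi_subset_Ioi hρ.out.le
    have h := integral_Ioi_of_hasDerivAt_of_tendsto
      ((hP (t - cout ρ) ρ hρ).continuousAt.continuousWithinAt)
      (fun σ hσ ↦ hP (t - cout ρ) σ (hsub hσ)) ((hFo_int _).mono_set hsub) (hPlim _)
    rw [sub_add_cancel] at h
    rw [h]
    abel
  have hQtail : ∀ t, ∀ ρ ∈ Ioi r₀,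
      Q t ρ = -∫ σ in Ioi ρ, F (t + cin ρ - cin σ) σ := by
    intro t ρ hρ
    have hsub : Ioi ρ ⊆ Ioi r₀ := Ioi_subset_Ioi hρ.out.le
    have h := integral_Ioi_of_hasDerivAt_of_tendsto
      ((hQ (t + cin ρ) ρ hρ).continuousAt.continuousWithinAt)
      (fun σ hσ ↦ hQ (t + cin ρ) σ (hsub hσ)) ((hFi_int _).mono_set hsub) (hQlim _)
    rw [add_sub_cancel_right] at h
    rw [h]
    abel
  have key : ∀ n : ℕ, ∀ t, ∀ ρ ∈ Ioi r₀, ‖G t ρ‖ ≤ B₀ * (K * W ρ) ^ n / n.factorial := by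
    intro n
    induction n with
    | zero =>
      intro t ρ hρ
      simpa using hB t ρ hρ
    | succ n ih =>
      intro t ρ hρ
      have hsub : Ioi ρ ⊆ Ioi r₀ := Ioi_subset_Ioi hρ.out.le
      set c : ℝ := B₀ * K ^ n / n.factorial with hc
      have hc0 : 0 ≤ c := by positivity
      obtain ⟨hint, hval⟩ := integral_Ioi_weight_mul_tail_pow hw hw0 hwi n hρ
      have hgint : IntegrableOn (fun σ ↦ c * (W σ ^ n * w σ)) (Ioi ρ) := hint.const_mul c
      have hgval : ∫ σ in Ioi ρ, c * (W σ ^ n * w σ) = c * (W ρ ^ (n + 1) / (n + 1)) := by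
        rw [MeasureTheory.integral_const_mul, hval]
      have hpt : ∀ (τ : ℝ → ℝ), ∀ σ ∈ Ioi ρ, ‖F (τ σ) σ‖ ≤ c * (W σ ^ n * w σ) := by
        intro τ σ hσ
        have hσ₀ : σ ∈ Ioi r₀ := hsub hσ
        calc ‖F (τ σ) σ‖ ≤ w σ * ‖G (τ σ) σ‖ := hF _ σ hσ₀
          _ ≤ w σ * (B₀ * (K * W σ) ^ n / n.factorial) :=
              mul_le_mul_of_nonneg_left (ih _ σ hσ₀) (hw0 σ hσ₀)
          _ = c * (W σ ^ n * w σ) := by rw [hc, mul_pow]; ring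
      have hPb : ∀ t, ‖P t ρ‖ ≤ c * (W ρ ^ (n + 1) / (n + 1)) := by
        intro t
        rw [hPtail t ρ hρ, norm_neg, ← hgval]
        exact norm_integral_le_of_norm_le hgint
          ((ae_restrict_iff' measurableSet_Ioi).2
            (Eventually.of_forall (hpt fun σ ↦ t - cout ρ + cout σ)))
      have hQb : ∀ t, ‖Q t ρ‖ ≤ c * (W ρ ^ (n + 1) / (n + 1)) := by
        intro t
        rw [hQtail t ρ hρ, norm_neg, ← hgval]
        exact norm_integral_le_of_norm_le hgint
          ((ae_restrict_iff' measurableSet_Ioi).2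
            (Eventually.of_forall (hpt fun σ ↦ t + cin ρ - cin σ)))
      -- hence the bound on `Gt`, and by the Bernstein step on `G`
      have hGtb : ∀ t, ‖Gt t ρ‖ ≤ c * (W ρ ^ (n + 1) / (n + 1)) := by
        intro t
        have h2 : Gt t ρ = (2 : ℝ)⁻¹ • (Q t ρ - P t ρ) := by
          rw [hQP t ρ hρ, smul_smul]; norm_num
        rw [h2, norm_smul, norm_inv, Real.norm_two]
        have := norm_sub_le (Q t ρ) (P t ρ)
        nlinarith [hPb t, hQb t, this]
      have hG := hBern ρ hρ _ hGtb t
      refine hG.trans (le_of_eq ?_)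
      rw [hc, Nat.factorial_succ]
      push_cast
      field_simp
      ring
  -- conclusion: the Picard bounds tend to `0`
  intro t ρ hρ
  have hlim : Tendsto (fun n : ℕ ↦ B₀ * (K * W ρ) ^ n / n.factorial) atTop (𝓝 0) := by
    have := (FloorSemiring.tendsto_pow_div_factorial_atTop (K * W ρ)).const_mul B₀
    simpa [mul_div_assoc] using this
  have h0 : ‖G t ρ‖ ≤ 0 := ge_of_tendsto' hlim fun n ↦ key n t ρ hρ
  exact norm_le_zero_iff.1 h0

end EternalPapapetrou.ModeRigidity

end Summit.FinalStateConjecture.FinalStateConjecture.Theorems
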